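import Literature.NumberTheory.Sieve.QuadraticRootsPrimeModuliDFIAssembly
import Literature.NumberTheory.Sieve.QuadraticRootsPrimeModuliDFIUnsmoothing
import Literature.NumberTheory.Sieve.QuadraticRootsPrimeModuliDFIProposition2
import HarnessLib

/-!
# Duke–Friedlander–Iwaniec 1995: the theorem from Theorem 5 and Proposition 4 alone

Topic `Literature/NumberTheory/Sieve`.  With Propositions 1 and 2 now consequences of
Proposition 4 (`dukeFriedlanderIwaniec1995_proposition1_of_proposition4`, §4, file
`QuadraticRootsPrimeModuliDFIUnsmoothing.lean`; `dukeFriedlanderIwaniec1995_proposition2_of_proposition4`,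
§5, file `QuadraticRootsPrimeModuliDFIProposition2.lean`), the trust base of the named fact
`dukeFriedlanderIwaniec1995_quadraticRoots_primeModuli` (W. Duke, J. B. Friedlander, H. Iwaniec,
Ann. of Math. 141 (1995), Theorem p. 424) along the printed lines is reduced to exactly two named
facts of `QuadraticRootsPrimeModuliDFI.lean`:

* `dukeFriedlanderIwaniec1995_theorem5` — the elementary sieve for complex sequences (§6), and
* `dukeFriedlanderIwaniec1995_proposition4` — the smoothed linear forms (§2–§4: Poincaré series
  on `Γ₀(q)`, the spectral theorem, Kuznetsov's formula, Weil's bound; the one non-elementary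
  input);

and that of the merged fact `dukeFriedlanderIwaniecToth_quadraticRoots_primeModuli`
(`PolynomialCongruences.lean`) to these two plus `toth2000_quadraticRoots_primeModuli`
(positive discriminant).  PROVED here (no new named fact):

* `dukeFriedlanderIwaniec1995_quadraticRoots_primeModuli_of_theorem5_of_proposition4`;
* `dukeFriedlanderIwaniecToth_quadraticRoots_primeModuli_of_theorem5_of_proposition4_of_toth`.

## References

* W. Duke, J. B. Friedlander, H. Iwaniec, *Equidistribution of roots of a quadratic congruence to
  prime moduli*, Ann. of Math. (2) 141 (1995), 423–441: Theorem (p. 424), Propositions 1, 2, 4,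
  Theorem 5, §§4–7. [cite: DukeFriedlanderIwaniec1995, Theorem p. 424 and §§4–7]
* Á. Tóth, *Roots of quadratic congruences*, IMRN 2000:14, 719–739. [cite: Toth2000, main theorem]
-/

namespace Literature.NumberTheory.Sieve

/-- **DFI's theorem from Theorem 5 and Proposition 4**: for `f = aX² + 2bX + c ∈ ℤ[X]` with
`ac − b² > 0` and `h ≠ 0`, `∑_{p ≤ x} ρ_h(p) = o(π(x))` — the named fact
`dukeFriedlanderIwaniec1995_quadraticRoots_primeModuli` — follows from the sieve theorem
(`dukeFriedlanderIwaniec1995_theorem5`) and the spectral bound for smoothed linear forms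
(`dukeFriedlanderIwaniec1995_proposition4`): §4 gives Proposition 1, §5 gives Proposition 2, §7
assembles. [cite: DukeFriedlanderIwaniec1995, §§4, 5, 7] -/
theorem dukeFriedlanderIwaniec1995_quadraticRoots_primeModuli_of_theorem5_of_proposition4
    (H5 : dukeFriedlanderIwaniec1995_theorem5) (H4 : dukeFriedlanderIwaniec1995_proposition4) :
    dukeFriedlanderIwaniec1995_quadraticRoots_primeModuli :=
  dukeFriedlanderIwaniec1995_quadraticRoots_primeModuli_of_theorem5 H5
    (dukeFriedlanderIwaniec1995_proposition1_of_proposition4 H4)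
    (dukeFriedlanderIwaniec1995_proposition2_of_proposition4 H4)

/-- **The merged Duke–Friedlander–Iwaniec–Tóth fact from Theorem 5, Proposition 4 and Tóth's
theorem.** [cite: DukeFriedlanderIwaniec1995, §§4, 5, 7]; [cite: Toth2000, main theorem] -/
theorem dukeFriedlanderIwaniecToth_quadraticRoots_primeModuli_of_theorem5_of_proposition4_of_toth
    (H5 : dukeFriedlanderIwaniec1995_theorem5) (H4 : dukeFriedlanderIwaniec1995_proposition4)
    (hT : toth2000_quadraticRoots_primeModuli) :
    dukeFriedlanderIwaniecToth_quadraticRoots_primeModuli :=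
  dukeFriedlanderIwaniecToth_quadraticRoots_primeModuli_of_dfi_of_toth
    (dukeFriedlanderIwaniec1995_quadraticRoots_primeModuli_of_theorem5_of_proposition4 H5 H4) hT

end Literature.NumberTheory.Sieve
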